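import Mathlib
import Literature.Algebra.Lie.ChevalleyEilenbergLowDegree
import HarnessLib

/-!
# The closed double-sum formula for the Chevalley–Eilenberg differential —
crux HeckeEigenvalueField (stmt-Langlands-13632), line Sketch, stub DICT-W6

Statement.  Let `R` be a commutative ring, `L` a Lie algebra over `R`, `M` an `L`-module and
`f ∈ C^{q+1}(L; M)` an alternating `(q+1)`-cochain (tree type
`Literature.Algebra.Lie.ChevalleyEilenberg.Cochain R L M (q + 1)`).  The tree's differential
`d : C^{q+1} → C^{q+2}` is CONSTRUCTED by Cartan's recursion `i_y d = θ_y - d i_y`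
([ChevalleyEilenberg1948] §23 (23.6)); this file proves that it is given by the printed closed formula
([ChevalleyEilenberg1948] (23.1), [BorelWallach2000] I §1.1 (2))
```
  (d f)(X₀, …, X_{q+1}) = Σᵢ (-1)ⁱ Xᵢ • f(X₀, …, X̂ᵢ, …)
      + Σ_{i<k} (-1)^{i+k} f([Xᵢ, X_k], X₀, …, X̂ᵢ, …, X̂_k, …),
```
the pairs `i < k` being enumerated as `(i, i.succAbove j)`, `j : Fin (q+1)` (for fixed `i`,
`i.succAbove j` runs over the indices `≠ i`; the `if` keeps those above `i`; `X ∘ i.succAbove ∘ j.succAbove`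
is the tuple with both removed).  This is exactly the right-hand side of the Maurer–Cartan identity of
the sibling file `…StubDictW2` (with the coefficient action in place of the directional derivative), so
that "cocycle `⇒` closed form" becomes a rewrite.

Proof.  Induction on `q`, for all `f` and `X`.  Write `X = (X₀, X')` and expand by the tree's
first-variable formula `d_succ_apply_cons`
(`(d f)(X₀, X') = X₀ • f(X') - Σᵢ f(X' with [X₀, X'ᵢ] in slot i) - (d (i_{X₀} f))(X')`):
* `X₀ • f(X')` is the `i = 0` term of the action sum;
* moving the modified slot to the front costs `(-1)ⁱ` (`AlternatingMap.map_insertNth`), which turns the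
  Leibniz terms into the pairs `(0, i+1)` of the bracket sum;
* `(d (i_{X₀} f))(X')` is expanded by the induction hypothesis (in degree `0` by `d_zero_apply`): its
  action sum gives the terms `i ≥ 1` (index shift `i ↦ i+1`, `Fin.succ_succAbove_zero/succ`), and its
  bracket sum gives the pairs with both indices `≥ 1`, the extra sign coming from swapping the bracket
  past `X₀` in the first two slots (`AlternatingMap.map_swap`).

References: C. Chevalley, S. Eilenberg, Trans. AMS 63 (1948), §23 (23.1), (23.6)
[ChevalleyEilenberg1948]; A. Borel, N. Wallach, *Continuous cohomology, discrete subgroups, and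
representations of reductive groups*, 2nd ed. (2000), I §1.1 (2) [BorelWallach2000].
-/

set_option linter.dupNamespace false -- project-wide: `Summit.Langlands.Langlands` is the mandated namespace

noncomputable section

namespace Summit.Langlands.Langlands.Theorems.HeckeEigenvalueField.Res

open Literature.Algebra.Lie.ChevalleyEilenberg

/-- The integer sign `(-1 : ℤ) ^ m` acting on a module agrees with the scalar sign
`(-1 : R) ^ m`. [folklore] -/
private theorem ce_neg_one_pow_zsmul_eq {R V : Type*} [Ring R] [AddCommGroup V] [Module R V]
    (m : ℕ) (y : V) : ((-1 : ℤ) ^ m) • y = ((-1 : R) ^ m) • y := by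
  rw [← Int.cast_smul_eq_zsmul R]
  simp

/-- Moving an updated slot of an alternating map to the front costs the sign of the cycle:
`f (w with slot j replaced by z) = (-1)^j f (z, w with slot j removed)`. [folklore] -/
private theorem ce_map_update_eq_smul_cons {R M N : Type*} [CommRing R] [AddCommGroup M]
    [Module R M] [AddCommGroup N] [Module R N] {n : ℕ} (f : M [⋀^Fin (n + 1)]→ₗ[R] N)
    (w : Fin (n + 1) → M) (j : Fin (n + 1)) (z : M) :
    f (Function.update w j z) =
      (-1 : R) ^ (j : ℕ) • f (Fin.cons z (fun l => w (j.succAbove l))) := by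
  rw [← Fin.insertNth_removeNth, AlternatingMap.map_insertNth, ce_neg_one_pow_zsmul_eq (R := R)]
  rfl

/-- Swapping the first two arguments of an alternating map changes the sign. [folklore] -/
private theorem ce_map_cons_cons_swap {R M N : Type*} [CommRing R] [AddCommGroup M]
    [Module R M] [AddCommGroup N] [Module R N] {n : ℕ} (f : M [⋀^Fin (n + 2)]→ₗ[R] N)
    (x y : M) (r : Fin n → M) :
    f (Fin.cons x (Fin.cons y r)) = -f (Fin.cons y (Fin.cons x r)) := by
  rw [← AlternatingMap.map_swap f (Fin.cons y (Fin.cons x r)) (i := 0) (j := 1) (by simp)]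
  congr 1
  funext l
  refine Fin.cases ?_ (fun l' => Fin.cases ?_ (fun l'' => ?_) l') l
  · simp
  · simp
  · have h0 : (l''.succ.succ : Fin (n + 2)) ≠ 0 := Fin.succ_ne_zero _
    have h1 : (l''.succ.succ : Fin (n + 2)) ≠ 1 := by
      rw [← Fin.succ_zero_eq_one]
      exact fun h => Fin.succ_ne_zero _ (Fin.succ_inj.mp h)
    simp [Equiv.swap_apply_of_ne_of_ne h0 h1]

/-- Removing the slot `k.succ` from a tuple keeps its head:
`f (X ∘ k.succ.succAbove) = f (X 0, X ∘ succ ∘ k.succAbove)`. [folklore] -/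
private theorem ce_map_comp_succ_succAbove {R M N : Type*} [CommRing R] [AddCommGroup M]
    [Module R M] [AddCommGroup N] [Module R N] {n : ℕ} (f : M [⋀^Fin (n + 1)]→ₗ[R] N)
    (X : Fin (n + 2) → M) (k : Fin (n + 1)) :
    f (fun l => X (k.succ.succAbove l)) =
      f (Matrix.vecCons (X 0) (fun l => X (k.succAbove l).succ)) := by
  congr 1
  funext l
  refine Fin.cases ?_ (fun l' => ?_) l
  · simp
  · simp [Fin.succ_succAbove_succ]

/-- Removing the slots `k.succ` and then `m.succ` from a tuple keeps its head; putting a new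
entry in front of the result and then swapping it past the head costs a sign. [folklore] -/
private theorem ce_map_cons_comp_succ_succAbove₂ {R M N : Type*} [CommRing R] [AddCommGroup M]
    [Module R M] [AddCommGroup N] [Module R N] {n : ℕ} (f : M [⋀^Fin (n + 2)]→ₗ[R] N)
    (X : Fin (n + 3) → M) (k : Fin (n + 2)) (m : Fin (n + 1)) (z : M) :
    f (Fin.cons z (fun l => X (k.succ.succAbove (m.succ.succAbove l)))) =
      -f (Matrix.vecCons (X 0) (Fin.cons z (fun l => X (k.succAbove (m.succAbove l)).succ))) := by
  have h : (fun l => X (k.succ.succAbove (m.succ.succAbove l))) =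
      Fin.cons (X 0) (fun l => X (k.succAbove (m.succAbove l)).succ) := by
    funext l
    refine Fin.cases ?_ (fun l' => ?_) l
    · simp
    · simp [Fin.succ_succAbove_succ]
  rw [h, ce_map_cons_cons_swap]
  rfl

/-- In an additive group, `-D = A + B` gives `t - S - D = (t + A) + (-S + B)` (the bookkeeping of
the inductive step). [folklore] -/
private theorem ce_assemble {N : Type*} [AddCommGroup N] {t S D A B : N} (hC : -D = A + B) :
    t - S - D = t + A + (-S + B) := by
  have hD : D = -(A + B) := by rw [← hC, neg_neg]
  rw [hD]
  abel

section CE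

variable {R L M : Type} [CommRing R] [LieRing L] [LieAlgebra R L] [AddCommGroup M] [Module R M]

/-- The Leibniz slot terms of Cartan's recursion, with the modified slot moved to the front:
`Σᵢ f(X₁, …, [X₀, X_{i+1}], …) = Σᵢ (-1)ⁱ f([X₀, X_{i+1}], X₁, …, X̂_{i+1}, …)`. [folklore] -/
private theorem ce_sum_map_update_tail (q : ℕ) (f : Cochain R L M (q + 1))
    (X : Fin (q + 2) → L) :
    ∑ i : Fin (q + 1), f (Function.update (Fin.tail X) i ⁅X 0, Fin.tail X i⁆) =
      ∑ j : Fin (q + 1), (-1 : R) ^ (j : ℕ) •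
        f (Fin.cons ⁅X 0, X j.succ⁆ (fun l => X (j.succAbove l).succ)) := by
  refine Finset.sum_congr rfl fun j _ => ?_
  rw [ce_map_update_eq_smul_cons]
  rfl

/-- First-index splitting of the action sum `Σᵢ (-1)ⁱ Xᵢ • f(…X̂ᵢ…)` into `i = 0` and `i = k + 1`.
[folklore] -/
private theorem ce_sumA [LieRingModule L M] (q : ℕ) (f : Cochain R L M (q + 1))
    (X : Fin (q + 2) → L) :
    (∑ i : Fin (q + 2), ((-1 : R) ^ (i : ℕ)) • ⁅X i, f (fun j => X (i.succAbove j))⁆) =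
      ⁅X 0, f (Fin.tail X)⁆ +
        ∑ k : Fin (q + 1), (-1 : R) ^ ((k : ℕ) + 1) •
          ⁅X k.succ, f (fun j => X (k.succ.succAbove j))⁆ := by
  rw [Fin.sum_univ_succ]
  simp only [Fin.val_zero, pow_zero, one_smul, Fin.zero_succAbove, Fin.val_succ]
  rfl

/-- First-index splitting of the bracket sum `Σ_{i<k} (-1)^{i+k} f([Xᵢ, X_k], …X̂ᵢ…X̂_k…)` into the
pairs `(0, j+1)` (all of them increasing, sign `-(-1)ʲ`) and the pairs `(k+1, ·)`. [folklore] -/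
private theorem ce_sumB (q : ℕ) (f : Cochain R L M (q + 1)) (X : Fin (q + 2) → L) :
    (∑ i : Fin (q + 2), ∑ j : Fin (q + 1),
        if (i : ℕ) < ((i.succAbove j : Fin (q + 2)) : ℕ) then
          ((-1 : R) ^ ((i : ℕ) + ((i.succAbove j : Fin (q + 2)) : ℕ))) •
            f (Fin.cons ⁅X i, X (i.succAbove j)⁆ (fun l => X (i.succAbove (j.succAbove l))))
        else 0) =
      -(∑ j : Fin (q + 1), (-1 : R) ^ (j : ℕ) •
          f (Fin.cons ⁅X 0, X j.succ⁆ (fun l => X (j.succAbove l).succ))) +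
        ∑ k : Fin (q + 1), ∑ j : Fin (q + 1),
          if (k : ℕ) + 1 < ((k.succ.succAbove j : Fin (q + 2)) : ℕ) then
            ((-1 : R) ^ ((k : ℕ) + 1 + ((k.succ.succAbove j : Fin (q + 2)) : ℕ))) •
              f (Fin.cons ⁅X k.succ, X (k.succ.succAbove j)⁆
                (fun l => X (k.succ.succAbove (j.succAbove l))))
          else 0 := by
  rw [Fin.sum_univ_succ]
  congr 1
  rw [← Finset.sum_neg_distrib]
  refine Finset.sum_congr rfl fun j _ => ?_
  simp only [Fin.val_zero, Fin.zero_succAbove, Fin.val_succ, zero_add]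
  rw [if_pos (Nat.succ_pos _), pow_succ, mul_neg_one, neg_smul]

end CE

/-- **Dictionary calculus W6 (closed formula for the Chevalley–Eilenberg differential).**
For a commutative ring `R`, a Lie algebra `L` over `R`, an `L`-module `M`, an alternating cochain
`f ∈ C^{q+1}(L; M)` and `X : Fin (q+2) → L`, the tree's differential (constructed by Cartan's recursion
`i_y d = θ_y - d i_y`, [ChevalleyEilenberg1948] (23.6)) is given by the printed formula
`(d f)(X₀,…,X_{q+1}) = Σᵢ (-1)ⁱ Xᵢ • f(…X̂ᵢ…) + Σ_{i<k} (-1)^{i+k} f([Xᵢ,X_k], …X̂ᵢ…X̂_k…)`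
(Chevalley–Eilenberg (23.1), Borel–Wallach I.1.1 (2)), the pairs `i < k` enumerated as
`(i, i.succAbove j)`.  Proof by induction on `q` from the first-variable expansion
`d_succ_apply_cons`, moving slots to the front with `AlternatingMap.map_insertNth` / `map_swap`.
[cite: ChevalleyEilenberg1948, §23 (23.6)] [cite: BorelWallach2000, I §1.1 (2)] -/
theorem stub_ce_d_succ_apply_eq_sum {R L M : Type} [CommRing R] [LieRing L] [LieAlgebra R L]
    [AddCommGroup M] [Module R M] [LieRingModule L M] [LieModule R L M] (q : ℕ)
    (f : Literature.Algebra.Lie.ChevalleyEilenberg.Cochain R L M (q + 1)) (X : Fin (q + 2) → L) :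
    Literature.Algebra.Lie.ChevalleyEilenberg.d R L M (q + 1) f X =
      (∑ i : Fin (q + 2), ((-1 : R) ^ (i : ℕ)) • ⁅X i, f (fun j => X (i.succAbove j))⁆) +
        ∑ i : Fin (q + 2), ∑ j : Fin (q + 1),
          if (i : ℕ) < ((i.succAbove j : Fin (q + 2)) : ℕ) then
            ((-1 : R) ^ ((i : ℕ) + ((i.succAbove j : Fin (q + 2)) : ℕ))) •
              f (Fin.cons ⁅X i, X (i.succAbove j)⁆ (fun l => X (i.succAbove (j.succAbove l))))
          else 0 := by
  induction q with
  | zero =>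
    -- `(d f)(X₀, X₁) = X₀ • f(X₁) - f([X₀, X₁]) - X₁ • f(X₀)`
    have hd := d_succ_apply_cons 0 f (X 0) (Fin.tail X)
    rw [Fin.cons_self_tail] at hd
    rw [hd, ce_sum_map_update_tail, ce_sumA, ce_sumB]
    refine ce_assemble ?_
    rw [d_zero_apply, ins_apply]
    simp only [Fin.sum_univ_succ, Fin.sum_univ_zero, add_zero, Fin.tail, Fin.val_zero, zero_add,
      pow_one, Fin.succ_succAbove_zero, Nat.not_lt_zero, if_false]
    rw [ce_map_comp_succ_succAbove, neg_one_smul]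
    simp only [Fin.zero_succAbove]
    rfl
  | succ q ih =>
    have hd := d_succ_apply_cons (q + 1) f (X 0) (Fin.tail X)
    rw [Fin.cons_self_tail] at hd
    rw [hd, ce_sum_map_update_tail, ce_sumA, ce_sumB]
    refine ce_assemble ?_
    -- expand `(d (i_{X₀} f))(X')` by the induction hypothesis
    rw [ih]
    simp only [ins_apply, Fin.tail]
    rw [neg_add]
    congr 1
    · -- the action terms `i ≥ 1`
      rw [← Finset.sum_neg_distrib]
      refine Finset.sum_congr rfl fun k _ => ?_
      rw [ce_map_comp_succ_succAbove, pow_succ, mul_neg_one, neg_smul]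
    · -- the bracket terms with both indices `≥ 1`
      rw [← Finset.sum_neg_distrib]
      refine Finset.sum_congr rfl fun k _ => ?_
      rw [Fin.sum_univ_succ (n := q + 1)]
      simp only [Fin.succ_succAbove_zero, Fin.val_zero, Nat.not_lt_zero, if_false, zero_add,
        Fin.succ_succAbove_succ, Fin.val_succ, Nat.add_lt_add_iff_right,
        ce_map_cons_comp_succ_succAbove₂]
      rw [← Finset.sum_neg_distrib]
      refine Finset.sum_congr rfl fun m _ => ?_
      split_ifs
      · rw [smul_neg, neg_inj]
        congr 1
        ring
      · rw [neg_zero]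

end Summit.Langlands.Langlands.Theorems.HeckeEigenvalueField.Res

end
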